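import Summits.CriticalPhenomena.PercolationContinuityZ3.Theorems.Transplant.KNCellsBoxProdZ2ChainTA
import Summits.CriticalPhenomena.PercolationContinuityZ3.Theorems.Transplant.KNLevelsChainTransfer
import Summits.CriticalPhenomena.PercolationContinuityZ3.Theorems.Transplant.KNCells2KitResidues
import HarnessLib

/-!
# Design (D): the STRAIGHT-RUN tube chain (`TubeAdvData`, KNCellsBoxProdZ2ChainTA) PACKAGED — (i) the ELONGATED inner routes of the face
# step's kit clause (Step IV's `h3` from a wired point source, p3-g2's wiring trick 14:46Z) and (ii) the ROOT PROBE residue (D8) in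
# straight-run form, `RootOblA`, repackaged into stmt-g5's `RootOblT` (KNCells2KitResidues) with no further hypothesis

builds on p205010 (kernel theorem, internal audit signed; external expert review pending) — nothing in this file uses p205010.
Lane `prim-bschramm`, seat `prim-bschramm-p2` (G4/D8, handed over by p3-g2 14:46Z); helper file (`--supports stmt-CriticalPhenomena-4575`).

The two generic transfers `KNLevels.lt_real_of_chain` (p221507) and `KSchA.hQ0_of_chain_sub` (p221100) take an abstract linked chain
`s : Fin (n+1) → TStep G'`; the instance's chains are straight runs `P : TubeAdvData W` (`s k := P.stepA X k`, true targets `P.coreT k`,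
enlarged targets `P.coreE k = P.coreT k ∪ P.Rim k`).  This file does the `Fin`-bookkeeping once:
* **`TubeAdvData.lt_real_of_advChain`** — per-step tube facts for `k ≤ nA` (subbox / support / source-off-region / count / kit clause towards
  `coreE k` inside `stepD k`, rim excess `≤ η ≤ δ/2`) under ANY weighting `W'` of the tube graph, a chain property of length `nA + 1` at
  `(δ ↦ ε'')`, a source bound `1 - δ < P_{W'}(root ↔ B₀)` for some `B₀ ⊆ X^{(0)}_0` (e.g. the start box, `startBox_subset_X_zero`), the last face
  `coreT nA ⊆ Ft` and a domination `P_{W'}(⋃ t ∈ Ft, root ↔ t) ≤ μA` give `1 - ε'' < μA` (use: `W' := restrW Qt (pinW Wt (wireSet S) ⊤)`,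
  `μA := P_{Wt}(linkIn Qt S Ft)`, `hdom :=` p3-g2's `hwire`);
* **`KSchA.RootOblA X S Δ' δr`** — for every direction a straight run under the root law cut to a sub-world `U' ⊆ Q_0 ∪ E_{0,du}` with the same
  per-step facts at accuracy `δr nA`, the monotone-wired first hop `1 - δr nA < P(root ↔ B₀)`, `B₀ ⊆ X^{(0)}_0`, and the far face inside
  `M_{a₀}(0 + du)`; **`rootOblT_of_rootOblA`** (pure repackaging) and **`rootObl_of_rootOblA`** (with the chain property of every length).
[cite: KozmaNitzan2024, §4 p. 27 (G₀), p. 28 ((32) at the root), Lemma 11 (pp. 22–23), Lemma 12 (pp. 23–25), p. 20 / p. 30 (Step IV)]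
-/

noncomputable section

open MeasureTheory ProbabilityTheory
open scoped ENNReal Classical

namespace Summit.CriticalPhenomena.PercolationContinuityZ3.Theorems

namespace Transplant

/-! ## §1 The straight-run chain transferred to a dominating event (the elongated inner routes) -/

namespace BoxProdZ2

namespace TubeAdvData

open Literature.Probability.Percolation Literature.Probability.LatticeModels SimpleGraph KNLevels

variable {W : Type} [DecidableEq W] (X : SimpleGraph W) [X.LocallyFinite]

/-- **THE ELONGATED ROUTES OF A STRAIGHT RUN, TRANSFERRED** (design (D), Step IV's `h3` from a wired point source): the straight-run chain
`P` in the tube graph over `P.π` under a weighting `W'`, with per-step subbox / support / count / kit-clause facts for `k ≤ nA`, rim excess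
`≤ η ≤ δ/2`, a chain property of length `nA + 1` at `(δ ↦ ε'')`, a source bound towards some `B₀ ⊆ X^{(0)}_0`, the far face inside `Ft` and
`P_{W'}(⋃ t ∈ Ft, root ↔ t) ≤ μA` give `1 - ε'' < μA`. [cite: KozmaNitzan2024, §4 Lemma 11 (pp. 22–23), Lemma 12 (pp. 23–25), p. 20 (Step IV)] -/
theorem lt_real_of_advChain (P : TubeAdvData W) (hsg : P.sg = 1 ∨ P.sg = -1)
    (hOK : ChainPlanar.Adv.AdvOK P.q P.q' P.s₁ P.ρ P.R' P.ℓ₀ P.nA) (hRl : P.Rlev + 1 ≤ P.R') (hRim : ∀ k, P.Rim k ⊆ P.stepD k)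
    (hπ : P.π.Nonempty) {p : unitInterval} {W' : Sym2 (W × Site 2) → unitInterval} {Ft B₀ : Finset (W × Site 2)} {μA : ℝ}
    {Δ' : ℕ} {δ ε'' η : ℝ}
    (hchain : ∀ (Wg : Sym2 (W × Site 2) → unitInterval) (s : Fin (P.nA + 1) → TStep (tubeGraph X P.π))
      (T' : Fin (P.nA + 1) → Finset (W × Site 2)) (η : ℝ),
      (∀ i, (s i).L.o = (s 0).L.o) →
      (∀ i : Fin P.nA, T' (Fin.castSucc i) ⊆ (s i.succ).L.X 0) →
      (∀ i, T' i ⊆ (s i).T) →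
      (∀ i, (s i).KitsAt Wg p Δ' δ) →
      η ≤ δ / 2 →
      (∀ i, (prodBernoulli Wg).real (⋃ t ∈ (s i).T \ T' i, openConn (s 0).L.o t) ≤ η) →
      1 - δ < (prodBernoulli Wg).real (s 0).L.reachB →
        1 - ε'' < (prodBernoulli Wg).real (⋃ t ∈ T' (Fin.last P.nA), openConn (s 0).L.o t))
    (hsub : ∀ k ≤ P.nA, IsSubbox (tubeGraph X P.π) W' p (P.stepD k)) (hfin : FinSupp W' P.Sfin)
    (hDS : ∀ k ≤ P.nA, P.stepD k ⊆ P.Sfin) (ho : ∀ k ≤ P.nA, P.root ∉ P.stepD k) (hoS : P.root ∈ P.Sfin) (hj : P.j₁ ≤ P.Rlev)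
    (hcount : 1 / (1 - (p : ℝ)) ^ (Δ' * P.N) ≤ δ * ((Finset.Icc P.j₀ P.j₁).card : ℝ))
    (hkits : ∀ k ≤ P.nA, ∀ j ∈ Finset.Icc P.j₀ P.j₁, ∃ (σ : SData (W × Site 2)) (Sz : Finset (W × Site 2)),
      SHyp (tubeLData X P.π (P.alo k) (P.ahi k) P.root P.Sfin) j σ ∧ σ.N ≤ P.N ∧
      (1 - (p : ℝ) ^ σ.sB) ^ σ.k ≤ δ ∧ Sz ⊆ (tubeLData X P.π (P.alo k) (P.ahi k) P.root P.Sfin).X j ∧ Sz ⊆ P.stepD k ∧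
      (∀ x ∈ σ.K, ∀ e ∈ σ.seed x, e ∉ wireSet (↑Sz : Set (W × Site 2))) ∧ (∀ x ∈ σ.K, σ.face x ⊆ Sz) ∧
      (∀ x ∈ σ.K, 1 - 3 * δ ≤ (prodBernoulli W').real {ω | ∃ u ∈ σ.face x,
        1 - δ < (prodBernoulli (pinW W' (wireSet (↑Sz : Set (W × Site 2))) ω)).real
          (⋃ t ∈ P.coreE k, openConnIn (↑(P.stepD k) : Set (W × Site 2)) u t)}))
    (hη : η ≤ δ / 2) (hexc : ∀ k ≤ P.nA, (prodBernoulli W').real (⋃ t ∈ P.Rim k, openConn P.root t) ≤ η)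
    (hB₀ : B₀ ⊆ (P.stepL X 0).X 0) (hsrc : 1 - δ < (prodBernoulli W').real (⋃ t ∈ B₀, openConn P.root t))
    (hTn : P.coreT P.nA ⊆ Ft) (hdom : (prodBernoulli W').real (⋃ t ∈ Ft, openConn P.root t) ≤ μA) :
    1 - ε'' < μA := by
  let s : Fin (P.nA + 1) → TStep (tubeGraph X P.π) := fun i => P.stepA X i
  let T' : Fin (P.nA + 1) → Finset (W × Site 2) := fun i => P.coreT i
  have hle : ∀ i : Fin (P.nA + 1), (i : ℕ) ≤ P.nA := fun i => Nat.lt_succ_iff.1 i.2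
  refine lt_real_of_chain (tubeGraph X P.π) hchain s T' (fun i => P.stepA_o X i) (fun i => ?_) (fun i => P.coreT_subset_coreE X i)
    (fun i => ?_) hη (fun i => ?_) ?_ ?_ hdom
  · -- the true targets link the chain
    show P.coreT (Fin.castSucc i) ⊆ (P.stepA X i.succ).L.X 0
    have : ((i.succ : Fin (P.nA + 1)) : ℕ) = (Fin.castSucc i : ℕ) + 1 := by simp
    rw [show P.stepA X (i.succ : ℕ) = P.stepA X ((Fin.castSucc i : ℕ) + 1) by rw [this]]
    exact P.coreT_subset_X_zero_succ X hsg _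
  · exact kitsAt_stepA X hsg hOK hRl hRim hπ (hle i) (hsub i (hle i)) hfin (hDS i (hle i)) (ho i (hle i)) hoS hj hcount (hkits i (hle i))
  · -- the excess of the enlarged target is inside the rim part
    refine le_trans (measureReal_mono ?_ (measure_ne_top _ _)) (hexc i (hle i))
    intro ω hω
    simp only [Set.mem_iUnion, exists_prop] at hω ⊢
    obtain ⟨t, ht, hωt⟩ := hω
    exact ⟨t, P.coreE_sdiff_subset X i ht, hωt⟩
  · -- the source bound: `B₀ ⊆ X^{(0)}_0`
    show 1 - δ < (prodBernoulli W').real (P.stepA X ((0 : Fin (P.nA + 1)) : ℕ)).L.reachB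
    rw [Fin.val_zero]
    refine hsrc.trans_le (measureReal_mono ?_ (measure_ne_top _ _))
    intro ω hω
    simp only [Set.mem_iUnion, exists_prop] at hω
    obtain ⟨t, ht, hωt⟩ := hω
    show ω ∈ (P.stepL X 0).reachB
    exact Set.mem_biUnion (Finset.mem_coe.2 (hB₀ ht)) hωt
  · -- the far face lies in `Ft`
    show P.coreT ((Fin.last P.nA : Fin (P.nA + 1)) : ℕ) ⊆ Ft
    rw [Fin.val_last]; exact hTn

end TubeAdvData

end BoxProdZ2

/-! ## §2 The root probe residue in straight-run form -/

namespace KNCells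

namespace KSchA

open Literature.Probability.Percolation Literature.Probability.LatticeModels SimpleGraph GadgetSystem ProbeHistory HSiteScheme Contour
open BoxProdZ2

variable {W : Type} [DecidableEq W] [Countable W] (X : SimpleGraph W) [X.LocallyFinite]
variable {A : Type*}

/-- **The root obligation in STRAIGHT-RUN form** (D8): for every direction `du` a straight-run tube chain `P : TubeAdvData W` rooted at the
scheme's root (sign `±1`, `AdvOK`, `Rlev + 1 ≤ R'`, rim parts inside the regions, nonempty window), a sub-world `U' ⊆ Q_0 ∪ E_{0,du}` containing
the root, under the root law cut to `U'` (`W0sub`): per step `k ≤ nA` the subbox property in the tube graph, the support facts, the source off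
the region, Step II's count and the per-level kit clause at accuracy `δr nA` towards the enlarged target `coreE k` inside `stepD k`, the rim
excess `≤ η ≤ δr nA / 2`; the monotone-wired first hop `1 - δr nA < P(root ↔ B₀)` towards some `B₀ ⊆ X^{(0)}_0`; and the far face `coreT nA`
inside `M_{a₀}(0 + du)`.  Straight-run twin of stmt-g5's `RootOblT`. [cite: KozmaNitzan2024, §4 p. 27 (G₀), p. 28 ((32) at the root), Lemma 11] -/
def RootOblA (S : KSchA (W × Site 2) A) (Δ' : ℕ) (δr : ℕ → ℝ) : Prop :=
  ∀ du : MDir, ∃ (P : TubeAdvData W) (U' B₀ : Finset (W × Site 2)) (η : ℝ),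
    (P.sg = 1 ∨ P.sg = -1) ∧ ChainPlanar.Adv.AdvOK P.q P.q' P.s₁ P.ρ P.R' P.ℓ₀ P.nA ∧ P.Rlev + 1 ≤ P.R' ∧
    (∀ k, P.Rim k ⊆ P.stepD k) ∧ P.π.Nonempty ∧ P.root = S.Γ.root ∧ U' ⊆ S.U0root du ∧ S.Γ.root ∈ U' ∧
    (∀ k ≤ P.nA, KNLevels.IsSubbox (tubeGraph X P.π) (S.W0sub (X □ zdGraph 2) U') S.p (P.stepD k)) ∧
    KNLevels.FinSupp (S.W0sub (X □ zdGraph 2) U') P.Sfin ∧ (∀ k ≤ P.nA, P.stepD k ⊆ P.Sfin) ∧ (∀ k ≤ P.nA, P.root ∉ P.stepD k) ∧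
    P.root ∈ P.Sfin ∧ P.j₁ ≤ P.Rlev ∧
    1 / (1 - (S.p : ℝ)) ^ (Δ' * P.N) ≤ δr P.nA * ((Finset.Icc P.j₀ P.j₁).card : ℝ) ∧
    (∀ k ≤ P.nA, ∀ j ∈ Finset.Icc P.j₀ P.j₁, ∃ (σ : KNLevels.SData (W × Site 2)) (Sz : Finset (W × Site 2)),
      KNLevels.SHyp (tubeLData X P.π (P.alo k) (P.ahi k) P.root P.Sfin) j σ ∧ σ.N ≤ P.N ∧
      (1 - (S.p : ℝ) ^ σ.sB) ^ σ.k ≤ δr P.nA ∧ Sz ⊆ (tubeLData X P.π (P.alo k) (P.ahi k) P.root P.Sfin).X j ∧ Sz ⊆ P.stepD k ∧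
      (∀ x ∈ σ.K, ∀ e' ∈ σ.seed x, e' ∉ wireSet (↑Sz : Set (W × Site 2))) ∧ (∀ x ∈ σ.K, σ.face x ⊆ Sz) ∧
      (∀ x ∈ σ.K, 1 - 3 * δr P.nA ≤ (prodBernoulli (S.W0sub (X □ zdGraph 2) U')).real {ω | ∃ u ∈ σ.face x,
        1 - δr P.nA < (prodBernoulli (pinW (S.W0sub (X □ zdGraph 2) U') (wireSet (↑Sz : Set (W × Site 2))) ω)).real
          (⋃ t ∈ P.coreE k, openConnIn (↑(P.stepD k) : Set (W × Site 2)) u t)})) ∧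
    η ≤ δr P.nA / 2 ∧
    (∀ k ≤ P.nA, (prodBernoulli (S.W0sub (X □ zdGraph 2) U')).real (⋃ t ∈ P.Rim k, openConn S.Γ.root t) ≤ η) ∧
    B₀ ⊆ (P.stepL X 0).X 0 ∧
    1 - δr P.nA < (prodBernoulli (S.W0sub (X □ zdGraph 2) U')).real (⋃ t ∈ B₀, openConn S.Γ.root t) ∧
    P.coreT P.nA ⊆ S.Γ.M S.Γ.a₀ ((0 : Site 2) + stepVec du)

variable {X}

omit [Countable W] in
/-- **`RootOblA ⟹ RootOblT`** (pure repackaging: the straight run as a `Fin (nA+1)`-indexed linked chain of target steps with true targets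
`coreT k` inside the enlarged `coreE k`, `kitsAt_stepA`, the rim bound, the first hop into `B₀ ⊆ X^{(0)}_0`).
[cite: KozmaNitzan2024, §4 p. 28 ((32) at the root), Lemma 11 (pp. 22–23)] -/
theorem rootOblT_of_rootOblA {S : KSchA (W × Site 2) A} {Δ' : ℕ} {δr : ℕ → ℝ} (hA : RootOblA X S Δ' δr) : RootOblT X S Δ' δr := by
  intro du
  obtain ⟨P, U', B₀, η, hsg, hOK, hRl, hRim, hπ, hroot, hU', hrU, hsub, hfin, hDS, ho, hoS, hj, hcount, hkits, hη, hexc, hB₀, hsrc, hTn⟩ :=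
    hA du
  have hle : ∀ i : Fin (P.nA + 1), (i : ℕ) ≤ P.nA := fun i => Nat.lt_succ_iff.1 i.2
  refine ⟨P.nA, P.π, U', fun i => P.stepA X i, fun i => P.coreT i, η, hU', hrU, fun i => ?_, fun i => ?_,
    fun i => P.coreT_subset_coreE X i, fun i => ?_, hη, fun i => ?_, ?_, ?_⟩
  · rw [TubeAdvData.stepA_o, hroot]
  · -- the true targets link the chain
    show P.coreT (Fin.castSucc i) ⊆ (P.stepA X i.succ).L.X 0
    have : ((i.succ : Fin (P.nA + 1)) : ℕ) = (Fin.castSucc i : ℕ) + 1 := by simp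
    rw [show P.stepA X (i.succ : ℕ) = P.stepA X ((Fin.castSucc i : ℕ) + 1) by rw [this]]
    exact P.coreT_subset_X_zero_succ X hsg _
  · exact TubeAdvData.kitsAt_stepA X hsg hOK hRl hRim hπ (hle i) (hsub i (hle i)) hfin (hDS i (hle i)) (ho i (hle i)) hoS hj hcount
      (hkits i (hle i))
  · -- the excess of the enlarged target is inside the rim part
    refine le_trans (measureReal_mono ?_ (measure_ne_top _ _)) (hexc i (hle i))
    intro ω hω
    simp only [Set.mem_iUnion, exists_prop] at hω ⊢
    obtain ⟨t, ht, hωt⟩ := hω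
    exact ⟨t, P.coreE_sdiff_subset X i ht, hωt⟩
  · -- the first hop: `B₀ ⊆ X^{(0)}_0`
    show 1 - δr P.nA < (prodBernoulli (S.W0sub (X □ zdGraph 2) U')).real (P.stepA X ((0 : Fin (P.nA + 1)) : ℕ)).L.reachB
    rw [Fin.val_zero]
    refine hsrc.trans_le (measureReal_mono ?_ (measure_ne_top _ _))
    intro ω hω
    simp only [Set.mem_iUnion, exists_prop] at hω
    obtain ⟨t, ht, hωt⟩ := hω
    show ω ∈ (P.stepL X 0).reachB
    rw [← hroot] at hωt
    exact Set.mem_biUnion (Finset.mem_coe.2 (hB₀ ht)) hωt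
  · -- the far face lies in `M_{a₀}(0 + du)`
    show P.coreT ((Fin.last P.nA : Fin (P.nA + 1)) : ℕ) ⊆ S.Γ.M S.Γ.a₀ ((0 : Site 2) + stepVec du)
    rw [Fin.val_last]; exact hTn

/-- **`RootOblA` + the chain property of every length at `(δr n ↦ δc)` ⟹ `RootObl`** (`rootObl_of_rootOblT ∘ rootOblT_of_rootOblA`).
[cite: KozmaNitzan2024, §4 p. 28 ((32) at the root), Lemma 12 (pp. 23–25)] -/
theorem rootObl_of_rootOblA {S : KSchA (W × Site 2) A} {Δ' : ℕ} {δr : ℕ → ℝ}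
    (hchain : ∀ (n : ℕ) (π : Finset W) (Wg : Sym2 (W × Site 2) → unitInterval) (s : Fin (n + 1) → KNLevels.TStep (tubeGraph X π))
      (T' : Fin (n + 1) → Finset (W × Site 2)) (η : ℝ),
      (∀ i : Fin (n + 1), (s i).L.o = (s 0).L.o) →
      (∀ i : Fin n, T' (Fin.castSucc i) ⊆ (s i.succ).L.X 0) →
      (∀ i : Fin (n + 1), T' i ⊆ (s i).T) →
      (∀ i : Fin (n + 1), (s i).KitsAt Wg S.p Δ' (δr n)) →
      η ≤ δr n / 2 →
      (∀ i : Fin (n + 1), (prodBernoulli Wg).real (⋃ t ∈ (s i).T \ T' i, openConn (s 0).L.o t) ≤ η) →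
      1 - δr n < (prodBernoulli Wg).real (s 0).L.reachB →
        1 - S.δc < (prodBernoulli Wg).real (⋃ t ∈ T' (Fin.last n), openConn (s 0).L.o t))
    (hA : RootOblA X S Δ' δr) : RootObl (X □ zdGraph 2) S :=
  rootObl_of_rootOblT hchain (rootOblT_of_rootOblA hA)

end KSchA

end KNCells

end Transplant

end Summit.CriticalPhenomena.PercolationContinuityZ3.Theorems

end
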